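import Literature.Geometry.Symplectic.AlmostComplexTangentBundle
import HarnessLib

/-!
# The complex tangent bundle of an almost complex manifold is the tangent bundle

Topic `Literature/Geometry/Symplectic`. Companion to `AlmostComplexTangentBundle.lean`: there the
tangent bundle of a manifold `M` with an almost complex structure `J` was given the structure of
a complex vector bundle `J.complexTangentCore` / `J.complexTangentBundle` (McDuff–Salamon 2017,
§2.6: "`(TM, J)`"), with abstract fibres `ℂᵏ` identified with `(T_x M, J_x)` pointwise by
`J.complexTangentCore_fiberEquiv x`. Here we prove that these pointwise identifications assemble
to a **fibrewise real-linear homeomorphism of total spaces**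
`J.tangentHomeomorph : J.complexTangentCore.TotalSpace ≃ₜ TangentBundle I M` over the identity
of `M`, under which multiplication by `i` becomes `J` (`tangentHomeomorph_apply_I_smul`); i.e.
`J.complexTangentBundle` IS the tangent bundle `TM` with the complex structure `J`, as a
topological complex vector bundle — the object whose Chern classes McDuff–Salamon (Remark 2.7.2,
Remark 4.1.10) call `cᵢ(TM, J)`.

Proof: in the trivialisation of `J.complexTangentCore` indexed by `x₀` and the tangent
trivialisation at `x₀`, the map reads `(x, ζ) ↦ (x, C(x₀; x) β_{x₀}⁻¹ ζ)` and its inverse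
`(x, w) ↦ (x, β_{x₀} C(x₀; x)⁻¹ w)` (`C` the interpolating endomorphism `interpAt`, invertible on
the base set, `β_{x₀}` the complex model `modelIsoAt`), both continuous. No facts, no `sorry`.

## References

* D. McDuff, D. Salamon, *Introduction to Symplectic Topology*, 3rd ed. (2017), §2.6,
  Remark 2.7.2, Remark 4.1.10. [McDuffSalamon2017]
-/

noncomputable section

open scoped Manifold ContDiff Topology
open Set Function Filter Module

namespace Literature.Geometry.Symplectic

namespace AlmostComplexStructure

variable {E : Type*} [NormedAddCommGroup E] [NormedSpace ℝ E] [FiniteDimensional ℝ E]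
  {H : Type*} [TopologicalSpace H] {I : ModelWithCorners ℝ E H}
  {M : Type*} [TopologicalSpace M] [ChartedSpace H M] [IsManifold I 1 M] {n : WithTop ℕ∞}
  (J : AlmostComplexStructure I n M)

/-- **The identification of the complex tangent bundle with the tangent bundle**, on total spaces:
`⟨x, z⟩ ↦ ⟨x, β_x⁻¹ z⟩` (`complexTangentCore_fiberEquiv`). [folklore] -/
def toTangentBundle (p : J.complexTangentCore.TotalSpace) : TangentBundle I M :=
  ⟨p.proj, J.complexTangentCore_fiberEquiv p.proj p.snd⟩

/-- The inverse identification `⟨x, v⟩ ↦ ⟨x, β_x v⟩`. [folklore] -/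
def ofTangentBundle (q : TangentBundle I M) : J.complexTangentCore.TotalSpace :=
  ⟨q.proj, (J.complexTangentCore_fiberEquiv q.proj).symm q.snd⟩

/-- `ofTangentBundle ∘ toTangentBundle = id`. [folklore] -/
theorem ofTangentBundle_toTangentBundle (p : J.complexTangentCore.TotalSpace) :
    J.ofTangentBundle (J.toTangentBundle p) = p := by
  obtain ⟨x, z⟩ := p
  exact congrArg (Bundle.TotalSpace.mk x) ((J.complexTangentCore_fiberEquiv x).symm_apply_apply z)

/-- `toTangentBundle ∘ ofTangentBundle = id`. [folklore] -/
theorem toTangentBundle_ofTangentBundle (q : TangentBundle I M) :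
    J.toTangentBundle (J.ofTangentBundle q) = q := by
  obtain ⟨x, v⟩ := q
  exact congrArg (Bundle.TotalSpace.mk x) ((J.complexTangentCore_fiberEquiv x).apply_symm_apply v)

omit [FiniteDimensional ℝ E] in
/-- `C(x₀; x) · (C(x₀; x)⁻¹ Φ C(x; x)) = Φ` on the base set: the real transition map from the
trivialisation indexed by `x` to the one indexed by `x₀`, followed by `C(x₀; x)`, is the tangent
coordinate change. [folklore] -/
theorem interpAt_mul_realTrans {x₀ x : M} (hx : x ∈ J.cBaseSet x₀) :
    J.interpAt x₀ x * J.realTrans x x₀ x = tangentCoordChange I x x₀ x := by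
  rw [realTrans, interpAt_self, mul_one, ← mul_assoc, Ring.mul_inverse_cancel _ hx.2, one_mul]

/-- **The identification in coordinates**: in the tangent trivialisation at `x₀` the image of `p`
is `(x, C(x₀; x) β_{x₀}⁻¹ ζ)`, `(x, ζ)` the coordinates of `p` in the complex trivialisation
indexed by `x₀`. [folklore] -/
theorem trivializationAt_toTangentBundle {x₀ : M} {p : J.complexTangentCore.TotalSpace}
    (hp : p.proj ∈ J.cBaseSet x₀) :
    trivializationAt E (TangentSpace I : M → Type _) x₀ (J.toTangentBundle p) =
      (p.proj, J.interpAt x₀ p.proj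
        ((J.modelIsoAt x₀).symm (J.complexTangentCore.localTriv x₀ p).2)) := by
  obtain ⟨x, z⟩ := p
  rw [VectorBundleCore.localTriv_apply, TangentBundle.trivializationAt_apply]
  change ((x, tangentCoordChange I x x₀ x ((J.modelIsoAt x).symm z)) : M × E) =
    (x, J.interpAt x₀ x ((J.modelIsoAt x₀).symm (J.cCoordChange x x₀ x z)))
  rw [cCoordChange_apply J (J.mem_cBaseSet_self x) hp, transModel_apply,
    ContinuousLinearEquiv.symm_apply_apply]
  exact congrArg (fun T : E →L[ℝ] E ↦ ((x, T ((J.modelIsoAt x).symm z)) : M × E))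
    (interpAt_mul_realTrans J hp).symm

/-- The identification in the inverse direction, in coordinates: `(x, w) ↦ (x, β_{x₀} C(x₀; x)⁻¹ w)`.
[folklore] -/
theorem localTriv_ofTangentBundle {x₀ : M} {q : TangentBundle I M} (hq : q.proj ∈ J.cBaseSet x₀) :
    J.complexTangentCore.localTriv x₀ (J.ofTangentBundle q) =
      (q.proj, J.modelIsoAt x₀ (Ring.inverse (J.interpAt x₀ q.proj)
        (trivializationAt E (TangentSpace I : M → Type _) x₀ q).2)) := by
  obtain ⟨x, v⟩ := q
  rw [VectorBundleCore.localTriv_apply, TangentBundle.trivializationAt_apply]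
  change ((x, J.cCoordChange x x₀ x (J.modelIsoAt x v)) : M × (Fin (finrank ℝ E / 2) → ℂ)) =
    (x, J.modelIsoAt x₀ (Ring.inverse (J.interpAt x₀ x) (tangentCoordChange I x x₀ x v)))
  rw [cCoordChange_apply J (J.mem_cBaseSet_self x) hq, transModel_apply,
    ContinuousLinearEquiv.symm_apply_apply, realTrans, interpAt_self, mul_one]
  rfl

/-- `x ↦ C(x₀; x)⁻¹` is continuous on the base set. [folklore] -/
theorem continuousOn_inverse_interpAt (x₀ : M) :
    ContinuousOn (fun x ↦ Ring.inverse (J.interpAt x₀ x)) (J.cBaseSet x₀) := fun x hx ↦ by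
  haveI : CompleteSpace E := FiniteDimensional.complete ℝ E
  obtain ⟨u, hu⟩ := hx.2
  have h1 : ContinuousAt Ring.inverse (J.interpAt x₀ x) := by
    rw [← hu]
    exact NormedRing.inverse_continuousAt u
  exact h1.comp_continuousWithinAt ((continuousOn_interpAt J x₀).mono (fun y hy ↦ hy.1) x hx)

/-- The identification is continuous on the domain of each complex trivialisation. [folklore] -/
theorem continuousOn_toTangentBundle (x₀ : M) :
    ContinuousOn J.toTangentBundle (J.complexTangentCore.localTriv x₀).source := by
  have hsrc : ∀ {p : J.complexTangentCore.TotalSpace},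
      p ∈ (J.complexTangentCore.localTriv x₀).source ↔ p.proj ∈ J.cBaseSet x₀ := fun {p} ↦
    VectorBundleCore.mem_localTriv_source _ _ p
  have hmaps : (J.complexTangentCore.localTriv x₀).source ⊆
      J.toTangentBundle ⁻¹' (trivializationAt E (TangentSpace I : M → Type _) x₀).source := by
    intro p hp
    rw [mem_preimage, Bundle.Trivialization.mem_source, TangentBundle.trivializationAt_baseSet,
      ← extChartAt_source I]
    exact (hsrc.1 hp).1
  rw [(trivializationAt E (TangentSpace I : M → Type _) x₀).toOpenPartialHomeomorph
    |>.continuousOn_iff_continuousOn_comp_left hmaps]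
  have hg : ContinuousOn (fun q : M × (Fin (finrank ℝ E / 2) → ℂ) ↦
      ((q.1, J.interpAt x₀ q.1 ((J.modelIsoAt x₀).symm q.2)) : M × E)) (J.cBaseSet x₀ ×ˢ univ) :=
    continuousOn_fst.prodMk ((((continuousOn_interpAt J x₀).mono fun x hx ↦ hx.1).comp
      continuousOn_fst fun q hq ↦ hq.1).clm_apply
        ((J.modelIsoAt x₀).symm.continuous.comp_continuousOn continuousOn_snd))
  refine (hg.comp (Bundle.Trivialization.continuousOn _) fun p hp ↦ ⟨hsrc.1 hp, mem_univ _⟩).congr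
    fun p hp ↦ ?_
  exact trivializationAt_toTangentBundle J (hsrc.1 hp)

/-- **The identification `J.complexTangentCore.TotalSpace → TM` is continuous.** [folklore] -/
theorem continuous_toTangentBundle : Continuous J.toTangentBundle :=
  continuous_iff_continuousAt.2 fun p ↦ (continuousOn_toTangentBundle J p.proj).continuousAt
    ((J.complexTangentCore.localTriv p.proj).open_source.mem_nhds
      ((VectorBundleCore.mem_localTriv_source _ _ p).2 (J.mem_cBaseSet_self p.proj)))

/-- The inverse identification is continuous over each base set. [folklore] -/
theorem continuousOn_ofTangentBundle (x₀ : M) :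
    ContinuousOn J.ofTangentBundle
      ((Bundle.TotalSpace.proj : TangentBundle I M → M) ⁻¹' J.cBaseSet x₀) := by
  have hmaps : (Bundle.TotalSpace.proj : TangentBundle I M → M) ⁻¹' J.cBaseSet x₀ ⊆
      J.ofTangentBundle ⁻¹' (J.complexTangentCore.localTriv x₀).source := fun q hq ↦
    (VectorBundleCore.mem_localTriv_source J.complexTangentCore x₀ (J.ofTangentBundle q)).2 hq
  rw [(J.complexTangentCore.localTriv x₀).toOpenPartialHomeomorph
    |>.continuousOn_iff_continuousOn_comp_left hmaps]
  have hg : ContinuousOn (fun q : M × E ↦ ((q.1, J.modelIsoAt x₀ (Ring.inverse (J.interpAt x₀ q.1) q.2)) :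
      M × (Fin (finrank ℝ E / 2) → ℂ))) (J.cBaseSet x₀ ×ˢ univ) :=
    continuousOn_fst.prodMk ((J.modelIsoAt x₀).continuous.comp_continuousOn
      ((((continuousOn_inverse_interpAt J x₀).comp continuousOn_fst fun q hq ↦ hq.1)).clm_apply
        continuousOn_snd))
  have hT : ContinuousOn (trivializationAt E (TangentSpace I : M → Type _) x₀)
      ((Bundle.TotalSpace.proj : TangentBundle I M → M) ⁻¹' J.cBaseSet x₀) :=
    (Bundle.Trivialization.continuousOn _).mono fun q hq ↦ by
      rw [Bundle.Trivialization.mem_source, TangentBundle.trivializationAt_baseSet, ← extChartAt_source I]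
      exact hq.1
  refine (hg.comp hT fun q hq ↦ ⟨hq, mem_univ _⟩).congr fun q hq ↦ ?_
  exact localTriv_ofTangentBundle J hq

/-- **The inverse identification `TM → J.complexTangentCore.TotalSpace` is continuous.**
[folklore] -/
theorem continuous_ofTangentBundle : Continuous J.ofTangentBundle :=
  continuous_iff_continuousAt.2 fun q ↦ (continuousOn_ofTangentBundle J q.proj).continuousAt
    (((J.isOpen_cBaseSet q.proj).preimage
      (FiberBundle.continuous_proj E (TangentSpace I : M → Type _))).mem_nhds
      (J.mem_cBaseSet_self q.proj))

/-- **The complex tangent bundle is homeomorphic to the tangent bundle over `M`**, fibrewise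
linearly and intertwining `i` with `J` (McDuff–Salamon 2017, §2.6: the complex vector bundle
`(TM, J)`). [cite: McDuffSalamon2017, §2.6] -/
def tangentHomeomorph : J.complexTangentCore.TotalSpace ≃ₜ TangentBundle I M where
  toFun := J.toTangentBundle
  invFun := J.ofTangentBundle
  left_inv := ofTangentBundle_toTangentBundle J
  right_inv := toTangentBundle_ofTangentBundle J
  continuous_toFun := continuous_toTangentBundle J
  continuous_invFun := continuous_ofTangentBundle J

/-- The homeomorphism covers the identity of `M`. [folklore] -/
@[simp] theorem proj_tangentHomeomorph (p : J.complexTangentCore.TotalSpace) :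
    (J.tangentHomeomorph p).proj = p.proj :=
  rfl

/-- On the fibre over `x` the homeomorphism is the real-linear isomorphism
`complexTangentCore_fiberEquiv x`. [folklore] -/
theorem tangentHomeomorph_apply_mk (x : M) (z : J.complexTangentCore.Fiber x) :
    J.tangentHomeomorph ⟨x, z⟩ = ⟨x, J.complexTangentCore_fiberEquiv x z⟩ :=
  rfl

/-- **Multiplication by `i` on the complex tangent bundle is `J` on the tangent bundle.**
[cite: McDuffSalamon2017, §2.6] -/
theorem tangentHomeomorph_apply_I_smul (x : M) (z : J.complexTangentCore.Fiber x) :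
    J.tangentHomeomorph ⟨x, Complex.I • z⟩ = ⟨x, J x (J.complexTangentCore_fiberEquiv x z)⟩ := by
  rw [tangentHomeomorph_apply_mk, complexTangentCore_fiberEquiv_I]

/-- The homeomorphism is additive on fibres. [folklore] -/
theorem tangentHomeomorph_apply_add (x : M) (z w : J.complexTangentCore.Fiber x) :
    J.tangentHomeomorph ⟨x, z + w⟩ =
      ⟨x, J.complexTangentCore_fiberEquiv x z + J.complexTangentCore_fiberEquiv x w⟩ := by
  rw [tangentHomeomorph_apply_mk, map_add]

/-- The homeomorphism is real-homogeneous on fibres. [folklore] -/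
theorem tangentHomeomorph_apply_real_smul (x : M) (r : ℝ) (z : J.complexTangentCore.Fiber x) :
    J.tangentHomeomorph ⟨x, r • z⟩ = ⟨x, r • J.complexTangentCore_fiberEquiv x z⟩ := by
  rw [tangentHomeomorph_apply_mk, (J.complexTangentCore_fiberEquiv x).map_smul]

end AlmostComplexStructure

end Literature.Geometry.Symplectic

end
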